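import Literature.Computability.Learning.VNStageFP
import Literature.Computability.Cryptography.FpGLCandidate
import Literature.Computability.Learning.DPDecodeFP
import HarnessLib

/-!
# The `𝔽_p`-Goldreich–Levin stage of the `AC⁰[p]` learner's hypothesis in `FP`

Machine-layer groundwork for the named fact `Literature.Computability.Learning.cikk_learn_AC0Mod`
(CIKK 2016, Cor. 5.4): the direct-product oracle of the GL stage, `glStageP` of `AmpPRun.lean`
(the candidate `glCandG` for `f'^k(x⃗)` read as `k` bits), as a string function
`candVecPFn H` for an arbitrary predictor string function `H` (the NW predictor; the vN stage
`vnPredFn H` of `VNStageFP.lean` is called on the blocks it builds). On `⟨Gr, row⟩`,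
`Gr = ⟨V, ⟨⟨1ⁿ, ⟨1ᵏ, 1^β⟩⟩, ⟨1^{kk}, ⟨seeds, ⟨guesses, ⟨θN, θD⟩⟩⟩⟩⟩⟩` (vN record, dimensions,
the `kk` seeds of `k` field elements, the `kk` guesses, the threshold `θN/θD`) and the row
`row = tupleBits` of `k` points of `UJ` as `(n+β)`-bit strings (`encRow`: the point, then the
`β` bits of its junk quotient):

* `encRow`/`decodeRow` (a total decoding, junk capped at `B - 1`), `blockN` (the bits of the
  block `(x⃗', r)` computed from the row and a position vector) with `blockN_eq`;
* list recipes `IsRepL`, `repsListL`, `seedCombL`, `guessDotL`, `glValuesL`, `glTestL`,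
  `glCandL`, `candVecN` and their identification with `glCandN` (`FpGLCandidate.lean`), hence
  with `glCandG`/`glStageP` (`candVecN_eq`);
* the code `candVec_codeFP` and the string function `candVecPFn H` (`∈ FP` for `H ∈ FP`) with
  **`candVecPFn_apply_genuine`**: on the genuine record, for every row of strings `v`,
  `candVecPFn H ⟨Gr, tupleBits v⟩ = List.ofFn (glStageP (vnStageP f h₁ c) (θN/θD) sg (decodeRow ∘ v))`
  — the hypothesis `hG` of `decodeFn_apply`.

## References

* M. Carmosino, R. Impagliazzo, V. Kabanets, A. Kolokolova, *Learning algorithms from natural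
  proofs*, CCC 2016, Thm. 4.2, Claim 4.4, Thm. 4.7, §5 [CarmosinoImpagliazzoKabanetsKolokolova2016].
* S. Arora, B. Barak, *Computational Complexity: A Modern Approach*, CUP 2009, §1.3 [AroraBarak2009].
-/

open Polynomial

namespace Literature.Computability.Learning

open Literature.Computability.Complexity Literature.Computability.Complexity.Brick
  Literature.Computability.Complexity.Plumb Literature.Computability.MetaComplexity
  Literature.Computability.MetaComplexity.GFDesign Literature.Computability.Cryptography
  Literature.Computability.Complexity.GaussRank _root_.Computability Finset CodeFP

variable {p : ℕ} [hp : Fact p.Prime] {n k β T kk : ℕ}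

/-! ### Rows: points with junk as `(n+β)`-bit strings -/

/-- A point with junk as an `(n+β)`-bit string: the point, then the bits of the junk quotient.
[folklore] -/
def encRow (u : UJ n p β) : Fin (n + β) → Bool := Fin.append u.1 fun e => (u.2 : ℕ).testBit e

/-- **The total decoding of an `(n+β)`-bit string** as a point with junk (junk capped at `B - 1`).
[folklore] -/
def decodeRow (hB : 0 < jB p β) (v : Fin (n + β) → Bool) : UJ n p β :=
  (fun j => v (Fin.castAdd β j), ⟨min (posVal fun e => v (Fin.natAdd n e)) (jB p β - 1), by omega⟩)

omit hp in
/-- A number below `2^β` is the value of its `β` bits. [folklore] -/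
theorem posVal_testBit {q : ℕ} (hq : q < 2 ^ β) : posVal (fun e : Fin β => q.testBit e) = q := by
  unfold posVal
  have h : (fun e : Fin β => q.testBit e) = (boolFunEquivFin β).symm ⟨q, hq⟩ := by
    funext e
    simp only [boolFunEquivFin, Equiv.symm_trans_apply, Equiv.arrowCongr_symm, Equiv.arrowCongr_apply, Equiv.symm_symm,
      Equiv.coe_refl, Function.comp_apply, id_eq, finTwoEquiv, Equiv.coe_fn_mk, Nat.testBit_eq_decide_div_mod_eq]
    rcases Nat.mod_two_eq_zero_or_one (q / 2 ^ (e : ℕ)) with h | h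
    · simp [h, Fin.ext_iff]
    · simp [h, Fin.ext_iff]
  rw [h, Equiv.apply_symm_apply]

/-- Decoding an encoded point gives it back. [folklore] -/
theorem decodeRow_encRow (hB : 0 < jB p β) (u : UJ n p β) : decodeRow hB (encRow (n := n) u) = u := by
  obtain ⟨x, q⟩ := u
  have hq2 : (q : ℕ) < 2 ^ β := lt_of_lt_of_le q.isLt (le_trans (Nat.le_mul_of_pos_right _ hp.out.pos) jB_mul_le)
  refine Prod.ext (funext fun j => by simp [decodeRow, encRow]) (Fin.ext ?_)
  simp only [decodeRow, encRow, Fin.append_right]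
  rw [posVal_testBit hq2]
  have := q.isLt
  omega

/-! ### The block of a row of strings and a position vector -/

/-- Point `i` of the row string. [folklore] -/
def rowJunkN (p nn ββ : ℕ) (row : List Bool) (i : ℕ) : ℕ :=
  min (bitsToNat ((row.drop (i * (nn + ββ) + nn)).takeD ββ false)) (2 ^ ββ / p - 1)

/-- **The bits of the block `(x⃗', r)`** computed from the row string and the position vector, bit
by bit in the block layout (`innerEquiv`): the point bits, then the `β` bits of `rᵢ + p qᵢ`.
[folklore] -/
def blockN (p nn k' ββ : ℕ) (row : List Bool) (r : List (ZMod p)) : List Bool :=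
  (List.range (k' * nn + k' * ββ)).map fun q =>
    if q < k' * nn then row.getD (q / nn * (nn + ββ) + q % nn) false
    else ((r.getD ((q - k' * nn) / ββ) 0).val + p * rowJunkN p nn ββ row ((q - k' * nn) / ββ)).testBit ((q - k' * nn) % ββ)

omit hp in
/-- The block layout: point bit `(i, j)` sits at `i·n + j`. [folklore] -/
theorem innerEquiv_inl_val (i : Fin k) (j : Fin n) : ((innerEquiv n k β (Sum.inl (i, j)) : Fin (k * n + k * β)) : ℕ) = i * n + j := by
  simp [innerEquiv, finProdFinEquiv]; ring

omit hp in
/-- The block layout: position bit `(i, e)` sits at `kn + i·β + e`. [folklore] -/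
theorem innerEquiv_inr_val (i : Fin k) (e : Fin β) :
    ((innerEquiv n k β (Sum.inr (i, e)) : Fin (k * n + k * β)) : ℕ) = k * n + (i * β + e) := by
  simp [innerEquiv, finProdFinEquiv]; ring

omit hp in
/-- An `ofFn` read at a `Fin` index. [folklore] -/
theorem getD_ofFn {α : Type*} {m : ℕ} (f : Fin m → α) (i : Fin m) (d : α) : (List.ofFn f).getD (i : ℕ) d = f i := by
  rw [List.getD_eq_getElem _ _ (by simp), List.getElem_ofFn]

omit hp in
/-- Bits of `tupleBits`. [folklore] -/
theorem getD_tupleBits {m : ℕ} (v : Fin k → (Fin m → Bool)) (i : Fin k) (j : Fin m) :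
    (tupleBits v).getD ((i : ℕ) * m + j) false = v i j := by
  have hlt : (i : ℕ) * m + j < k * m := by
    have h1 : (i : ℕ) + 1 ≤ k := i.isLt
    have := Nat.mul_le_mul_right m h1
    rw [add_mul, one_mul] at this
    have := j.isLt
    omega
  rw [tupleBits, List.getD_eq_getElem _ _ (by simpa using hlt), List.getElem_ofFn]
  have hidx : finProdFinEquiv.symm (⟨(i : ℕ) * m + j, hlt⟩ : Fin (k * m)) = (i, j) := by
    rw [Equiv.symm_apply_eq]; apply Fin.ext; simp [finProdFinEquiv]; ring
  rw [hidx]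

omit hp in
/-- The junk window of `tupleBits`. [folklore] -/
theorem junkWindow_tupleBits (v : Fin k → (Fin (n + β) → Bool)) (i : Fin k) :
    ((tupleBits v).drop ((i : ℕ) * (n + β) + n)).takeD β false = List.ofFn fun e : Fin β => v i (Fin.natAdd n e) := by
  have hle : (i : ℕ) * (n + β) + n + β ≤ k * (n + β) := by
    have h1 : (i : ℕ) + 1 ≤ k := i.isLt
    have := Nat.mul_le_mul_right (n + β) h1
    rw [add_mul, one_mul] at this
    omega
  rw [tupleBits, drop_takeD_ofFn _ hle]
  refine congrArg List.ofFn (funext fun e => ?_)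
  have hidx : finProdFinEquiv.symm (⟨(i : ℕ) * (n + β) + n + e, by have := e.isLt; omega⟩ : Fin (k * (n + β))) =
      (i, Fin.natAdd n e) := by
    rw [Equiv.symm_apply_eq]; apply Fin.ext; simp [finProdFinEquiv, Fin.natAdd]; ring
  simp only [hidx]

omit hp in
/-- The junk recipe on `tupleBits` is the capped junk of `decodeRow`. [folklore] -/
theorem rowJunkN_tupleBits (hB : 0 < jB p β) (v : Fin k → (Fin (n + β) → Bool)) (i : Fin k) :
    rowJunkN p n β (tupleBits v) i = ((decodeRow hB (v i)).2 : ℕ) := by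
  rw [rowJunkN, junkWindow_tupleBits, bitsToNat_ofFn_eq_posVal]
  rfl

/-- A bit of the encoded position. [folklore] -/
theorem encPos_apply (q : Fin (jB p β)) (r : ZMod p) (e : Fin β) : encPos q r e = (encPosN q r).testBit e := by
  unfold encPos
  simp only [boolFunEquivFin, Equiv.symm_trans_apply, Equiv.arrowCongr_symm, Equiv.arrowCongr_apply, Equiv.symm_symm,
    Equiv.coe_refl, Function.comp_apply, id_eq, finTwoEquiv, Equiv.coe_fn_mk, Nat.testBit_eq_decide_div_mod_eq]
  rcases Nat.mod_two_eq_zero_or_one (encPosN q r / 2 ^ (e : ℕ)) with h | h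
  · simp [h, Fin.ext_iff]
  · simp [h, Fin.ext_iff]

/-- **The block recipe computes the bits of the block `(decodeRow ∘ v, r)`** for every row of
strings `v`. [folklore] -/
theorem blockN_eq (hB : 0 < jB p β) (v : Fin k → (Fin (n + β) → Bool)) (r : FVec p k) :
    blockN p n k β (tupleBits v) (List.ofFn r) = blockBits (encBlk (fun i => decodeRow hB (v i), r)) := by
  rw [blockN, blockBits, map_range_eq_ofFn]
  refine congrArg List.ofFn (funext fun q => ?_)
  obtain ⟨s, rfl⟩ : ∃ s, q = innerEquiv n k β s := ⟨_, ((innerEquiv n k β).apply_symm_apply q).symm⟩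
  rw [Equiv.symm_apply_apply]
  rcases s with ⟨i, j⟩ | ⟨i, e⟩
  · rw [innerEquiv_inl_val]
    have hlt : (i : ℕ) * n + j < k * n := by
      have h1 : (i : ℕ) + 1 ≤ k := i.isLt
      have := Nat.mul_le_mul_right n h1
      rw [add_mul, one_mul] at this
      have := j.isLt
      omega
    have hn : 0 < n := Nat.pos_of_ne_zero fun h => by subst h; exact absurd j.isLt (by simp)
    have hdiv : ((i : ℕ) * n + j) / n = i := by
      rw [mul_comm, Nat.mul_add_div hn, Nat.div_eq_of_lt j.isLt, add_zero]
    have hmod : ((i : ℕ) * n + j) % n = j := by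
      rw [mul_comm, Nat.mul_add_mod, Nat.mod_eq_of_lt j.isLt]
    rw [if_pos hlt, hdiv, hmod]
    simp only [blkBit, encBlk]
    rw [show (i : ℕ) * (n + β) + (j : ℕ) = (i : ℕ) * (n + β) + ((Fin.castAdd β j : Fin (n + β)) : ℕ) by simp, getD_tupleBits]
    rfl
  · rw [innerEquiv_inr_val]
    have hge : ¬ k * n + ((i : ℕ) * β + e) < k * n := by omega
    have hβ0 : 0 < β := Nat.pos_of_ne_zero fun h => by subst h; exact absurd e.isLt (by simp)
    have hdiv : (k * n + ((i : ℕ) * β + e) - k * n) / β = i := by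
      rw [Nat.add_sub_cancel_left, mul_comm, Nat.mul_add_div hβ0, Nat.div_eq_of_lt e.isLt, add_zero]
    have hmod : (k * n + ((i : ℕ) * β + e) - k * n) % β = e := by
      rw [Nat.add_sub_cancel_left, mul_comm, Nat.mul_add_mod, Nat.mod_eq_of_lt e.isLt]
    rw [if_neg hge, hdiv, hmod]
    simp only [blkBit, encBlk]
    rw [encPos_apply, encPosN, getD_ofFn, rowJunkN_tupleBits hB v i]

/-! ### The list recipes -/

/-- The first nonzero entry of a list is `1`. [folklore] -/
def IsRepL (l : List (ZMod p)) : Bool := decide (l.getD (l.findIdx fun x => !decide (x = 0)) 0 = 1)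

/-- The enumeration of the canonical coefficient vectors as lists. [folklore] -/
def repsListL (p kk : ℕ) [Fact p.Prime] : List (List (ZMod p)) :=
  ((List.range (p ^ kk)).map (digitsL p kk)).filter IsRepL

/-- `r_c = Σ_t c_t sᵗ` on lists (`k'` coordinates). [folklore] -/
def seedCombL (k' : ℕ) (S : List (List (ZMod p))) (c : List (ZMod p)) : List (ZMod p) :=
  (List.range k').map fun j => ((List.range c.length).map fun t => c.getD t 0 * (S.getD t []).getD j 0).sum

/-- `Σ_t c_t σ_t` on lists. [folklore] -/
def guessDotL (σg c : List (ZMod p)) : ZMod p := ((List.range c.length).map fun t => c.getD t 0 * σg.getD t 0).sum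

/-- The shifted position vector `r_c + e_i` (`i = k'`: no shift). [folklore] -/
def shiftL (k' : ℕ) (r : List (ZMod p)) (i : ℕ) : List (ZMod p) :=
  (List.range k').map fun j => r.getD j 0 + if j = i then 1 else 0

/-- The values `B(r_c + eᵢ) - Σ_t c_t σ_t` over the enumeration (`i = k'`: no shift). [folklore] -/
def glValuesL (k' : ℕ) (Bq : List (ZMod p) → ZMod p) (S : List (List (ZMod p))) (σg : List (ZMod p)) (reps : List (List (ZMod p)))
    (i : ℕ) : List (ZMod p) :=
  reps.map fun c => Bq (shiftL k' (seedCombL k' S c) i) - guessDotL σg c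

/-- The cleared alignment test on lists. [folklore] -/
def glTestL (k' : ℕ) (Bq : List (ZMod p) → ZMod p) (S : List (List (ZMod p))) (σg : List (ZMod p)) (reps : List (List (ZMod p)))
    (θN θD : ℕ) (i : ℕ) (a : ZMod p) : Bool :=
  decide (∀ w ∈ (List.range p).map (fun w : ℕ => (w : ZMod p)),
    Nat.dist ((glValuesL k' Bq S σg reps i).count (a + w)) ((glValuesL k' Bq S σg reps k').count w) * θD ≤ 2 * θN * reps.length)

/-- The index of the least passing value (`p` if none). [folklore] -/
def glCandL (k' : ℕ) (Bq : List (ZMod p) → ZMod p) (S : List (List (ZMod p))) (σg : List (ZMod p)) (reps : List (List (ZMod p)))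
    (θN θD : ℕ) (i : ℕ) : ℕ :=
  (List.range p).findIdx fun a : ℕ => glTestL k' Bq S σg reps θN θD i (a : ZMod p)

/-- **The `k` output bits of the GL stage** on lists: bit `i` is `[candidate i = 1]`. [folklore] -/
def candBitsL (k' : ℕ) (Bq : List (ZMod p) → ZMod p) (S : List (List (ZMod p))) (σg : List (ZMod p)) (reps : List (List (ZMod p)))
    (θN θD : ℕ) : List Bool :=
  (List.range k').map fun i => decide (glCandL k' Bq S σg reps θN θD i = 1)

/-! ### The list recipes agree with the finite recipe `glCandN` -/

/-- `IsRepL` on an `ofFn` is `IsRep`. [folklore] -/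
theorem isRepL_ofFn (c : Fin kk → ZMod p) : IsRepL (List.ofFn c) = decide (IsRep c) := by
  classical
  unfold IsRepL IsRep
  set l := List.ofFn c with hl
  set t₀ := l.findIdx fun x => !decide (x = 0) with ht₀
  have hlen : l.length = kk := List.length_ofFn
  rw [decide_eq_decide]
  constructor
  · intro h1
    have hlt : t₀ < kk := by
      by_contra hge
      rw [not_lt] at hge
      rw [List.getD_eq_default _ _ (by rw [hlen]; exact hge)] at h1
      exact zero_ne_one h1
    refine ⟨⟨t₀, hlt⟩, fun t' ht' => ?_, ?_⟩
    · have h := List.not_of_lt_findIdx (xs := l) (p := fun x => !decide (x = 0)) (i := t') (by rw [← ht₀]; exact ht')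
      simp only [hl, List.getElem_ofFn] at h
      simpa using h
    · rw [List.getD_eq_getElem _ _ (by rw [hlen]; exact hlt)] at h1
      simpa [hl] using h1
  · rintro ⟨t, ht, h1⟩
    have hle : t₀ ≤ t := by
      by_contra hgt
      rw [not_le] at hgt
      have h := List.not_of_lt_findIdx (xs := l) (p := fun x => !decide (x = 0)) (i := t) (by rw [← ht₀]; exact hgt)
      simp only [hl, List.getElem_ofFn, Fin.eta] at h
      have hz : c t = 0 := by simpa using h
      rw [hz] at h1
      exact zero_ne_one h1
    have hge : (t : ℕ) ≤ t₀ := by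
      by_contra hgt
      rw [not_le] at hgt
      have hlt0 : t₀ < l.length := by rw [hlen]; omega
      have h := List.findIdx_getElem (xs := l) (p := fun x => !decide (x = 0)) (w := hlt0)
      have hz := ht ⟨t₀, by omega⟩ hgt
      simp only [← ht₀] at h
      simp [hl, hz] at h
    have : t₀ = t := le_antisymm hle hge
    rw [this, List.getD_eq_getElem _ _ (by rw [hlen]; exact t.isLt)]
    simpa [hl] using h1

/-- The list enumeration is the enumeration read through `ofFn`. [folklore] -/
theorem repsListL_eq : repsListL p kk = (repsList p kk).map List.ofFn := by
  rw [repsListL, repsList, allVecs, List.filter_map, List.filter_map, List.map_map]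
  have h1 : digitsL p kk = List.ofFn ∘ digitsFun p kk := funext fun N => (ofFn_digitsFun N).symm
  have h2 : (IsRepL ∘ digitsL p kk) = (fun c => decide (IsRep c)) ∘ digitsFun p kk := funext fun N => by
    simp only [Function.comp_apply, ← ofFn_digitsFun, isRepL_ofFn]
  rw [h2, h1]

/-- `seedCombL` on `ofFn`s is `seedComb`. [folklore] -/
theorem seedCombL_ofFn {k' : ℕ} (s : Fin kk → FVec p k') (c : Fin kk → ZMod p) :
    seedCombL k' (List.ofFn fun t => List.ofFn (s t)) (List.ofFn c) = List.ofFn (seedComb s c) := by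
  rw [seedCombL, map_range_eq_ofFn]
  refine congrArg List.ofFn (funext fun j => ?_)
  rw [List.length_ofFn, map_range_eq_ofFn, List.sum_ofFn, seedComb, Finset.sum_apply]
  refine Finset.sum_congr rfl fun t _ => ?_
  rw [getD_ofFn, getD_ofFn, getD_ofFn]
  simp [Pi.smul_apply, smul_eq_mul]

/-- `guessDotL` on `ofFn`s is `guessDot`. [folklore] -/
theorem guessDotL_ofFn (σg c : Fin kk → ZMod p) : guessDotL (List.ofFn σg) (List.ofFn c) = guessDot kk σg c := by
  rw [guessDotL, List.length_ofFn, map_range_eq_ofFn, List.sum_ofFn, guessDot]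
  refine Finset.sum_congr rfl fun t _ => ?_
  rw [getD_ofFn, getD_ofFn]

/-- `shiftL` on an `ofFn`. [folklore] -/
theorem shiftL_ofFn {k' : ℕ} (r : FVec p k') (i : ℕ) :
    shiftL k' (List.ofFn r) i = List.ofFn (r + (fun j : Fin k' => if (j : ℕ) = i then (1 : ZMod p) else 0)) := by
  rw [shiftL, map_range_eq_ofFn]
  refine congrArg List.ofFn (funext fun j => ?_)
  rw [getD_ofFn]
  rfl

/-- The shift by `i < k'` is `Pi.single i 1`; by `k'` it is `0`. [folklore] -/
theorem shift_eq_single {k' : ℕ} (i : Fin k') : (fun j : Fin k' => if (j : ℕ) = i then (1 : ZMod p) else 0) = Pi.single i 1 := by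
  funext j
  by_cases h : j = i
  · subst h; simp
  · rw [Pi.single_eq_of_ne h, if_neg (fun h' => h (Fin.ext h'))]

/-- No shift at index `k'`. [folklore] -/
theorem shift_eq_zero {k' : ℕ} : (fun j : Fin k' => if (j : ℕ) = k' then (1 : ZMod p) else 0) = 0 := by
  funext j; simp [ne_of_lt j.isLt]

/-- **The list values are the values of `glValues`** for `Bq = B ∘ (ofFn⁻¹)`. [folklore] -/
theorem glValuesL_eq {k' : ℕ} (B : FVec p k' → ZMod p) (s : Fin kk → FVec p k') (σg : Fin kk → ZMod p) (i : Option (Fin k')) :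
    glValuesL k' (fun l => B fun j => l.getD j 0) (List.ofFn fun t => List.ofFn (s t)) (List.ofFn σg) ((repsList p kk).map List.ofFn)
      (match i with | some i => (i : ℕ) | none => k') = glValues kk B σg s i := by
  unfold glValuesL glValues
  rw [List.map_map]
  refine List.map_congr_left fun c _ => ?_
  simp only [Function.comp_apply, seedCombL_ofFn, guessDotL_ofFn, shiftL_ofFn]
  congr 2
  funext j
  rw [getD_ofFn]
  cases i with
  | some i => rw [shift_eq_single]
  | none => rw [shift_eq_zero]

/-- **The list test is the cleared test `glTestN`.** [folklore] -/
theorem glTestL_eq {k' : ℕ} (B : FVec p k' → ZMod p) (s : Fin kk → FVec p k') (σg : Fin kk → ZMod p) (θN θD : ℕ) (i : Fin k')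
    (a : ZMod p) :
    glTestL k' (fun l => B fun j => l.getD j 0) (List.ofFn fun t => List.ofFn (s t)) (List.ofFn σg) ((repsList p kk).map List.ofFn)
      θN θD i a = glTestN kk B σg θN θD s i a := by
  rw [glTestL, glTestN, decide_eq_decide, glValuesL_eq B s σg (some i), glValuesL_eq B s σg none, List.length_map]
  constructor
  · intro h w
    have := h w (List.mem_map.2 ⟨w.val, List.mem_range.2 w.val_lt, ZMod.natCast_zmod_val w⟩)
    exact this
  · intro h w _; exact h w

/-- **The list candidate bits are the bits of `glCandN`.** [folklore] -/
theorem candBitsL_eq {k' : ℕ} (B : FVec p k' → ZMod p) (s : Fin kk → FVec p k') (σg : Fin kk → ZMod p) (θN θD : ℕ) :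
    candBitsL k' (fun l => B fun j => l.getD j 0) (List.ofFn fun t => List.ofFn (s t)) (List.ofFn σg) ((repsList p kk).map List.ofFn) θN θD =
      List.ofFn fun i : Fin k' => decide (glCandN kk B σg θN θD s i = 1) := by
  rw [candBitsL, map_range_eq_ofFn]
  refine congrArg List.ofFn (funext fun i => ?_)
  have hfind : glCandL k' (fun l => B fun j => l.getD j 0) (List.ofFn fun t => List.ofFn (s t)) (List.ofFn σg)
      ((repsList p kk).map List.ofFn) θN θD i = (List.range p).findIdx fun a : ℕ => glTestN kk B σg θN θD s i (a : ZMod p) := by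
    unfold glCandL
    congr 1
    funext a
    exact glTestL_eq B s σg θN θD i a
  rw [hfind, glCandN, decide_eq_decide]
  set a₀ := (List.range p).findIdx fun a : ℕ => glTestN kk B σg θN θD s i (a : ZMod p)
  have h1p : (1 : ℕ) < p := hp.out.one_lt
  constructor
  · intro h; rw [h, if_pos h1p]; simp
  · intro h
    by_cases hlt : a₀ < p
    · rw [if_pos hlt] at h
      have := congrArg ZMod.val h
      rwa [ZMod.val_natCast, Nat.mod_eq_of_lt hlt, ZMod.val_one] at this
    · rw [if_neg hlt] at h; exact absurd h zero_ne_one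

/-! ### The recipe of the stage and its genuine value -/

/-- The padded enumeration bound: `repsListL` through `N` (meant to be `p^{kk}`). [folklore] -/
def repsListLN (p kk N : ℕ) [Fact p.Prime] : List (List (ZMod p)) := ((List.range N).map (digitsL p kk)).filter IsRepL

/-- With the genuine pad the enumeration is `repsListL`. [folklore] -/
theorem repsListLN_pow : repsListLN p kk (p ^ kk) = repsListL p kk := rfl

/-- The typed GL record `⟨V, ⟨⟨1ⁿ, ⟨1ᵏ, 1^β⟩⟩, ⟨1^{kk}, ⟨1^N, ⟨seeds, ⟨guesses, ⟨θN, θD⟩⟩⟩⟩⟩⟩⟩`. [folklore] -/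
abbrev GlRecT (p : ℕ) : Type :=
  VnRecT × ((ℕ × (ℕ × ℕ)) × (ℕ × (ℕ × (List (List (ZMod p)) × (List (ZMod p) × (ℕ × ℕ))))))

/-- The oracle of the GL stage: the vN stage on the block of the row and the position vector,
read back as a field element. [cite: CarmosinoImpagliazzoKabanetsKolokolova2016, Claim 4.4 (proof: "`B_x(r) := C'(x, r)`")] -/
noncomputable def glOracleN (H : List Bool → List Bool) (V : VnRecT) (nn k' ββ : ℕ) (row : List Bool) (r : List (ZMod p)) : ZMod p :=
  ((bitsToNat (vnPredFn H (vnArgE (V, blockN p nn k' ββ row r))) : ℕ) : ZMod p)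

/-- **The recipe of the GL stage**: the `k` candidate bits. [cite: CarmosinoImpagliazzoKabanetsKolokolova2016, Thm. 4.2 / Claim 4.4] -/
noncomputable def candVecN (H : List Bool → List Bool) (Gr : GlRecT p) (row : List Bool) : List Bool :=
  candBitsL Gr.2.1.2.1 (glOracleN H Gr.1 Gr.2.1.1 Gr.2.1.2.1 Gr.2.1.2.2 row) Gr.2.2.2.2.1 Gr.2.2.2.2.2.1
    (repsListLN p Gr.2.2.1 Gr.2.2.2.1) Gr.2.2.2.2.2.2.1 Gr.2.2.2.2.2.2.2

/-- **The genuine GL record** of the vN record, the dimensions, the seeds and guesses and the threshold.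
[folklore] -/
def glRecOf (V : VnRecT) (n k β kk : ℕ) (s : Fin kk → FVec p k) (σ : Fin kk → ZMod p) (θN θD : ℕ) : GlRecT p :=
  (V, ((n, (k, β)), (kk, (p ^ kk, (List.ofFn fun t => List.ofFn (s t), (List.ofFn σ, (θN, θD)))))))

/-- `blockN` reads the position vector only below `k`. [folklore] -/
theorem blockN_congr_ofFn (nn k' ββ : ℕ) (row : List Bool) (l : List (ZMod p)) :
    blockN p nn k' ββ row l = blockN p nn k' ββ row (List.ofFn fun j : Fin k' => l.getD j 0) := by
  unfold blockN
  refine List.map_congr_left fun q hq => ?_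
  rw [List.mem_range] at hq
  by_cases hlt : q < k' * nn
  · rw [if_pos hlt, if_pos hlt]
  · rw [if_neg hlt, if_neg hlt]
    have hi : (q - k' * nn) / ββ < k' := Nat.div_lt_of_lt_mul (by rw [Nat.mul_comm ββ k']; omega)
    rw [show (q - k' * nn) / ββ = ((⟨(q - k' * nn) / ββ, hi⟩ : Fin k') : ℕ) from rfl, getD_ofFn]

/-- **The recipe computes the GL stage** on the genuine record, for every row of strings.
[cite: CarmosinoImpagliazzoKabanetsKolokolova2016, Thm. 4.2 / Claim 4.4 / Thm. 4.7] -/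
theorem candVecN_eq (hβ : p ≤ 2 ^ β) (H : List Bool → List Bool) (P : List Bool)
    (h₁ : (Fin (T * 2 * (k * n + k * β)) → Bool) → Bool)
    (hH : ∀ x : Fin (T * 2 * (k * n + k * β)) → Bool, H (boolPair P (List.ofFn x)) = [h₁ x])
    (f : (Fin n → Bool) → Bool) (c : VNCoins (SBlk n k p β) T p) (s : Fin kk → FVec p k) (σ : Fin kk → ZMod p)
    {θN θD : ℕ} (hθD : 0 < θD) (v : Fin k → (Fin (n + β) → Bool)) :
    candVecN H (glRecOf (vnRecOf P (dpGLP (fJ (p := p) (β := β) f)) c) n k β kk s σ θN θD) (tupleBits v) =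
      List.ofFn (glStageP (vnStageP f h₁ c) ((θN : ℝ) / θD) (s, σ) fun i => decodeRow (jB_pos hβ) (v i)) := by
  have hB := jB_pos hβ
  set V := vnRecOf P (dpGLP (fJ (p := p) (β := β) f)) c with hV
  -- the oracle is `C₂(x⃗', ·)`
  set Bf : FVec p k → ZMod p := fun r => vnStageP f h₁ c (fun i => decodeRow hB (v i), r) with hBf
  have horacle : glOracleN H V n k β (tupleBits v) = fun l => Bf fun j => l.getD j 0 := by
    funext l
    rw [glOracleN, blockN_congr_ofFn, blockN_eq hB, vnPredFn_apply_genuine H P h₁ hH, bitsToNat_natE, ZMod.natCast_zmod_val]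
    rfl
  unfold candVecN glRecOf
  simp only
  rw [horacle, repsListLN_pow, repsListL_eq, candBitsL_eq Bf s σ θN θD]
  refine congrArg List.ofFn (funext fun i => ?_)
  rw [glCandN_eq kk Bf σ hθD s]
  rfl

/-! ### The recipe as a polynomial-time code -/

section Codes

/-- The code of GL records. [folklore] -/
abbrev glRecE (p : ℕ) : GlRecT p → List Bool :=
  pairE vnRecE (pairE (pairE unE (pairE unE unE)) (pairE unE (pairE unE (pairE (rawE (rowE p)) (pairE (rowE p) (pairE natE natE))))))

/-- The code of the argument `⟨Gr, row⟩`. [folklore] -/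
abbrev glArgE (p : ℕ) : GlRecT p × List Bool → List Bool := pairE (glRecE p) strE

variable (p)

omit hp in
/-- `rowJunkN` is a code (context `((1ⁿ, 1^β), row)`, item `i`). [folklore] -/
theorem rowJunkN_codeFP : CodeFP (pairE (pairE (pairE unE unE) strE) natE) natE
    (fun t => rowJunkN p t.1.1.1 t.1.1.2 t.1.2 t.2) := by
  let ρ := ((ℕ × ℕ) × List Bool) × ℕ
  let eρ : ρ → List Bool := pairE (pairE (pairE unE unE) strE) natE
  have hn : CodeFP eρ natE (fun t => t.1.1.1) := (natOfUn.comp (fst _ _).fst'.fst').congr fun _ => rfl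
  have hβ : CodeFP eρ natE (fun t => t.1.1.2) := (natOfUn.comp (fst _ _).fst'.snd').congr fun _ => rfl
  have hβU : CodeFP eρ unE (fun t => t.1.1.2) := (fst _ _).fst'.snd'
  have hrow : CodeFP eρ strE (fun t => t.1.2) := (fst _ _).snd'
  have hi : CodeFP eρ natE (fun t => t.2) := snd _ _
  have hoffN : CodeFP eρ natE (fun t => t.2 * (t.1.1.1 + t.1.1.2) + t.1.1.1) :=
    (natAdd.comp ((natMul.comp (hi.pair (natAdd.comp (hn.pair hβ)))).pair hn)).congr fun _ => rfl
  have hoff : CodeFP eρ unE (fun t => min (t.2 * (t.1.1.1 + t.1.1.2) + t.1.1.1) t.1.2.length) :=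
    (unOfNatMin.comp ((strLength.comp hrow).pair hoffN)).congr fun _ => rfl
  have hwin : CodeFP eρ strE (fun t => (t.1.2.drop (t.2 * (t.1.1.1 + t.1.1.2) + t.1.1.1)).takeD t.1.1.2 false) :=
    (slice.comp (hoff.pair (hβU.pair hrow))).congr fun t => by
      congr 1
      by_cases h : t.2 * (t.1.1.1 + t.1.1.2) + t.1.1.1 ≤ t.1.2.length
      · rw [min_eq_left h]
      · rw [min_eq_right (le_of_not_ge h), List.drop_length, List.drop_eq_nil_of_le (le_of_not_ge h)]
  have hcap : CodeFP eρ natE (fun t => 2 ^ t.1.1.2 / p - 1) :=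
    (natSub.comp ((natDiv.comp ((natPow.comp ((const _ 2).pair hβU)).pair (const _ p))).pair (const _ 1))).congr fun _ => rfl
  exact (natMin.comp ((strVal.comp hwin).pair hcap)).congr fun t => by simp only [rowJunkN]

/-- `blockN` is a code on `⟨⟨⟨1ⁿ, ⟨1ᵏ, 1^β⟩⟩, row⟩, r⟩`. [folklore] -/
theorem blockN_codeFP : CodeFP (pairE (pairE (pairE unE (pairE unE unE)) strE) (rowE p)) strE
    (fun a => blockN p a.1.1.1 a.1.1.2.1 a.1.1.2.2 a.1.2 a.2) := by
  let α := ((ℕ × (ℕ × ℕ)) × List Bool) × List (ZMod p)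
  let eα : α → List Bool := pairE (pairE (pairE unE (pairE unE unE)) strE) (rowE p)
  let eρ : α × ℕ → List Bool := pairE eα natE
  have hA : CodeFP eρ eα (fun t => t.1) := fst _ _
  have hq : CodeFP eρ natE (fun t => t.2) := snd _ _
  have hnU : CodeFP eρ unE (fun t => t.1.1.1.1) := hA.fst'.fst'.fst'
  have hn : CodeFP eρ natE (fun t => t.1.1.1.1) := (natOfUn.comp hnU).congr fun _ => rfl
  have hkU : CodeFP eρ unE (fun t => t.1.1.1.2.1) := hA.fst'.fst'.snd'.fst'
  have hk : CodeFP eρ natE (fun t => t.1.1.1.2.1) := (natOfUn.comp hkU).congr fun _ => rfl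
  have hβU : CodeFP eρ unE (fun t => t.1.1.1.2.2) := hA.fst'.fst'.snd'.snd'
  have hβ : CodeFP eρ natE (fun t => t.1.1.1.2.2) := (natOfUn.comp hβU).congr fun _ => rfl
  have hrow : CodeFP eρ strE (fun t => t.1.1.2) := hA.fst'.snd'
  have hr : CodeFP eρ (rowE p) (fun t => t.1.2) := hA.snd'
  have hkn : CodeFP eρ natE (fun t => t.1.1.1.2.1 * t.1.1.1.1) := (natMul.comp (hk.pair hn)).congr fun _ => rfl
  -- point bits
  have hidx1 : CodeFP eρ natE (fun t => t.2 / t.1.1.1.1 * (t.1.1.1.1 + t.1.1.1.2.2) + t.2 % t.1.1.1.1) :=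
    (natAdd.comp ((natMul.comp ((natDiv.comp (hq.pair hn)).pair (natAdd.comp (hn.pair hβ)))).pair (natMod.comp (hq.pair hn)))).congr
      fun _ => rfl
  have hbit1 : CodeFP eρ bitE (fun t => t.1.1.2.getD (t.2 / t.1.1.1.1 * (t.1.1.1.1 + t.1.1.1.2.2) + t.2 % t.1.1.1.1) false) :=
    (strGetDNat.comp (hrow.pair hidx1)).congr fun _ => rfl
  -- position bits
  have hi : CodeFP eρ natE (fun t => (t.2 - t.1.1.1.2.1 * t.1.1.1.1) / t.1.1.1.2.2) :=
    (natDiv.comp ((natSub.comp (hq.pair hkn)).pair hβ)).congr fun _ => rfl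
  have he : CodeFP eρ natE (fun t => (t.2 - t.1.1.1.2.1 * t.1.1.1.1) % t.1.1.1.2.2) :=
    (natMod.comp ((natSub.comp (hq.pair hkn)).pair hβ)).congr fun _ => rfl
  have hri : CodeFP eρ natE (fun t => (t.1.2.getD ((t.2 - t.1.1.1.2.1 * t.1.1.1.1) / t.1.1.1.2.2) 0).val) :=
    (zmodVal.comp ((rawGetOr (zmodE p)).comp (hr.pair (hi.pair (const _ (0 : ZMod p)))))).congr fun _ => rfl
  have hjunk : CodeFP eρ natE (fun t => rowJunkN p t.1.1.1.1 t.1.1.1.2.2 t.1.1.2 ((t.2 - t.1.1.1.2.1 * t.1.1.1.1) / t.1.1.1.2.2)) :=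
    ((rowJunkN_codeFP p).comp (((hnU.pair hβU).pair hrow).pair hi)).congr fun _ => rfl
  have hval : CodeFP eρ natE (fun t => (t.1.2.getD ((t.2 - t.1.1.1.2.1 * t.1.1.1.1) / t.1.1.1.2.2) 0).val +
      p * rowJunkN p t.1.1.1.1 t.1.1.1.2.2 t.1.1.2 ((t.2 - t.1.1.1.2.1 * t.1.1.1.1) / t.1.1.1.2.2)) :=
    (natAdd.comp (hri.pair (natMul.comp ((const _ p).pair hjunk)))).congr fun _ => rfl
  have hbit2 : CodeFP eρ bitE (fun t => ((t.1.2.getD ((t.2 - t.1.1.1.2.1 * t.1.1.1.1) / t.1.1.1.2.2) 0).val +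
      p * rowJunkN p t.1.1.1.1 t.1.1.1.2.2 t.1.1.2 ((t.2 - t.1.1.1.2.1 * t.1.1.1.1) / t.1.1.1.2.2)).testBit
      ((t.2 - t.1.1.1.2.1 * t.1.1.1.1) % t.1.1.1.2.2)) :=
    (strGetDNat.comp ((strOfNat.comp hval).pair he)).congr fun t => (testBit_eq_getD_encodeNat _ _).symm
  have hitem : CodeFP eρ bitE (fun t => if decide (t.2 < t.1.1.1.2.1 * t.1.1.1.1) then
      t.1.1.2.getD (t.2 / t.1.1.1.1 * (t.1.1.1.1 + t.1.1.1.2.2) + t.2 % t.1.1.1.1) false else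
      ((t.1.2.getD ((t.2 - t.1.1.1.2.1 * t.1.1.1.1) / t.1.1.1.2.2) 0).val +
        p * rowJunkN p t.1.1.1.1 t.1.1.1.2.2 t.1.1.2 ((t.2 - t.1.1.1.2.1 * t.1.1.1.1) / t.1.1.1.2.2)).testBit
        ((t.2 - t.1.1.1.2.1 * t.1.1.1.1) % t.1.1.1.2.2)) :=
    ((natLt.comp (hq.pair hkn)).congr fun _ => rfl).ite hbit1 hbit2
  -- the range `kn + kβ` in unary
  have hlenU : CodeFP eα unE (fun a => a.1.1.2.1 * a.1.1.1 + a.1.1.2.1 * a.1.1.2.2) :=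
    (unAdd.comp ((Modp.unMul.comp ((fst _ _).fst'.snd'.fst'.pair (fst _ _).fst'.fst')).pair
      (Modp.unMul.comp ((fst _ _).fst'.snd'.fst'.pair (fst _ _).fst'.snd'.snd')))).congr fun _ => rfl
  have hmap := (CodeFP.map hitem).comp ((CodeFP.id eα).pair (urange.comp hlenU))
  exact (bitsToStr.comp hmap).congr fun a => by simp only [blockN, id, decide_eq_true_eq]

/-- `IsRepL` is a code. [folklore] -/
theorem isRepL_codeFP : CodeFP (rowE p) bitE IsRepL := by
  have hpred : CodeFP (pairE unitE (zmodE p)) bitE (fun t => !decide (t.2 = 0)) := (zmodIsZero.comp (snd _ _)).not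
  have hfind : CodeFP (pairE unitE (rowE p)) natE (fun q => q.2.findIdx fun x => !decide (x = 0)) := findIdxFP hpred
  have hfind' : CodeFP (rowE p) natE (fun l => l.findIdx fun x => !decide (x = 0)) :=
    (hfind.comp ((const (rowE p) ()).pair (CodeFP.id _))).congr fun _ => rfl
  have hget : CodeFP (rowE p) (zmodE p) (fun l => l.getD (l.findIdx fun x => !decide (x = 0)) 0) :=
    ((rawGetOr (zmodE p)).comp ((CodeFP.id _).pair (hfind'.pair (const _ (0 : ZMod p))))).congr fun _ => rfl
  exact ((eq zmodE_injective).comp (hget.pair (const _ (1 : ZMod p)))).congr fun l => by simp only [IsRepL]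

/-- `repsListLN` is a code on `(1^{kk}, 1^N)`. [folklore] -/
theorem repsListLN_codeFP : CodeFP (pairE unE unE) (rawE (rowE p)) (fun q => repsListLN p q.1 q.2) := by
  have hdig : CodeFP (pairE (pairE unE unE) natE) (rowE p) (fun t => digitsL p t.1.1 t.2) :=
    codeFP_digitsL.comp ((fst _ _).fst'.pair (snd _ _))
  have hall := (CodeFP.map hdig).comp ((CodeFP.id (pairE unE unE)).pair (urange.comp (snd unE unE)))
  have hfilt := (CodeFP.filter (σ := Unit) (eσ := unitE) (eα := rowE p) (p := fun t => IsRepL t.2)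
    ((isRepL_codeFP p).comp (snd _ _))).comp ((const _ ()).pair hall)
  exact hfilt.congr fun q => by simp only [repsListLN, id]

/-- `guessDotL` is a code. [folklore] -/
theorem guessDotL_codeFP : CodeFP (pairE (rowE p) (rowE p)) (zmodE p) (fun q => guessDotL q.1 q.2) := by
  let eρ := pairE (pairE (rowE p) (rowE p)) natE
  have hσ : CodeFP eρ (rowE p) (fun t => t.1.1) := (fst _ _).fst'
  have hc : CodeFP eρ (rowE p) (fun t => t.1.2) := (fst _ _).snd'
  have ht : CodeFP eρ natE (fun t => t.2) := snd _ _
  have hitem : CodeFP eρ (zmodE p) (fun t => t.1.2.getD t.2 0 * t.1.1.getD t.2 0) :=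
    (zmodMul.comp (((rawGetOr (zmodE p)).comp (hc.pair (ht.pair (const _ (0 : ZMod p))))).pair
      ((rawGetOr (zmodE p)).comp (hσ.pair (ht.pair (const _ (0 : ZMod p))))))).congr fun _ => rfl
  have hrange : CodeFP (pairE (rowE p) (rowE p)) (rawE natE) (fun q => List.range q.2.length) := urange.comp ((ulength _).comp (snd _ _))
  have hmap := (CodeFP.map hitem).comp ((CodeFP.id _).pair hrange)
  exact ((listSum zmodE_injective).comp hmap).congr fun q => by simp only [guessDotL, id]

/-- `seedCombL` is a code on `(1^{k'}, (S, c))`. [folklore] -/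
theorem seedCombL_codeFP : CodeFP (pairE unE (pairE (rawE (rowE p)) (rowE p))) (rowE p) (fun q => seedCombL q.1 q.2.1 q.2.2) := by
  let α := ℕ × (List (List (ZMod p)) × List (ZMod p))
  let eα : α → List Bool := pairE unE (pairE (rawE (rowE p)) (rowE p))
  -- inner item: context `(a, j)`, item `t`
  let eι := pairE (pairE eα natE) natE
  have hS : CodeFP eι (rawE (rowE p)) (fun t => t.1.1.2.1) := (fst _ _).fst'.snd'.fst'
  have hc : CodeFP eι (rowE p) (fun t => t.1.1.2.2) := (fst _ _).fst'.snd'.snd'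
  have hj : CodeFP eι natE (fun t => t.1.2) := (fst _ _).snd'
  have ht : CodeFP eι natE (fun t => t.2) := snd _ _
  have hrowt : CodeFP eι (rowE p) (fun t => t.1.1.2.1.getD t.2 []) :=
    ((rawGetOr (rowE p)).comp (hS.pair (ht.pair (const _ ([] : List (ZMod p)))))).congr fun _ => rfl
  have hinner : CodeFP eι (zmodE p) (fun t => t.1.1.2.2.getD t.2 0 * (t.1.1.2.1.getD t.2 []).getD t.1.2 0) :=
    (zmodMul.comp (((rawGetOr (zmodE p)).comp (hc.pair (ht.pair (const _ (0 : ZMod p))))).pair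
      ((rawGetOr (zmodE p)).comp (hrowt.pair (hj.pair (const _ (0 : ZMod p))))))).congr fun _ => rfl
  have hrangeI : CodeFP (pairE eα natE) (rawE natE) (fun s => List.range s.1.2.2.length) :=
    urange.comp ((ulength _).comp (fst _ _).snd'.snd')
  have hsumJ : CodeFP (pairE eα natE) (zmodE p) (fun s => ((List.range s.1.2.2.length).map fun t =>
      s.1.2.2.getD t 0 * (s.1.2.1.getD t []).getD s.2 0).sum) :=
    ((listSum zmodE_injective).comp ((CodeFP.map hinner).comp ((CodeFP.id _).pair hrangeI))).congr fun _ => by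
      simp only [id]
  have hrangeJ : CodeFP eα (rawE natE) (fun a => List.range a.1) := urange.comp (fst _ _)
  exact ((CodeFP.map hsumJ).comp ((CodeFP.id _).pair hrangeJ)).congr fun a => by simp only [seedCombL, id]

/-- `shiftL` is a code on `(1^{k'}, (r, i))`. [folklore] -/
theorem shiftL_codeFP : CodeFP (pairE unE (pairE (rowE p) natE)) (rowE p) (fun q => shiftL q.1 q.2.1 q.2.2) := by
  let eρ := pairE (pairE unE (pairE (rowE p) natE)) natE
  have hr : CodeFP eρ (rowE p) (fun t => t.1.2.1) := (fst _ _).snd'.fst'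
  have hi : CodeFP eρ natE (fun t => t.1.2.2) := (fst _ _).snd'.snd'
  have hj : CodeFP eρ natE (fun t => t.2) := snd _ _
  have hrj : CodeFP eρ (zmodE p) (fun t => t.1.2.1.getD t.2 0) :=
    ((rawGetOr (zmodE p)).comp (hr.pair (hj.pair (const _ (0 : ZMod p))))).congr fun _ => rfl
  have hδ : CodeFP eρ (zmodE p) (fun t => if decide (t.2 = t.1.2.2) then (1 : ZMod p) else 0) :=
    ((natEq.comp (hj.pair hi)).congr fun _ => rfl).ite (const _ 1) (const _ 0)
  have hitem : CodeFP eρ (zmodE p) (fun t => t.1.2.1.getD t.2 0 + if t.2 = t.1.2.2 then 1 else 0) :=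
    (zmodSub.comp (hrj.pair (zmodSub.comp ((const _ (0 : ZMod p)).pair hδ)))).congr fun t => by
      simp only [decide_eq_true_eq]; ring
  have hrange : CodeFP (pairE unE (pairE (rowE p) natE)) (rawE natE) (fun q => List.range q.1) := urange.comp (fst _ _)
  exact ((CodeFP.map hitem).comp ((CodeFP.id _).pair hrange)).congr fun q => rfl

variable {p}

/-- The context of the values map: `⟨⟨Gr, row⟩, i⟩`. [folklore] -/
abbrev glCtxE (p : ℕ) : (GlRecT p × List Bool) × ℕ → List Bool := pairE (glArgE p) natE

variable (p)

/-- **The oracle call is a code** (for `H ∈ FP`): `(⟨Gr, row⟩, r) ↦ B(r)`. [cite: AroraBarak2009, §1.3] -/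
theorem glOracleN_codeFP {H : List Bool → List Bool} (hH : H ∈ FP) :
    CodeFP (pairE (glArgE p) (rowE p)) (zmodE p) (fun q => glOracleN H q.1.1.1 q.1.1.2.1.1 q.1.1.2.1.2.1 q.1.1.2.1.2.2 q.1.2 q.2) := by
  have hH' : CodeFP (pairE vnRecE strE) strE (fun q => vnPredFn H (vnArgE q)) := ⟨vnPredFn H, vnPredFn_mem_FP hH, fun _ => rfl⟩
  have hV : CodeFP (pairE (glArgE p) (rowE p)) vnRecE (fun q => q.1.1.1) := (fst _ _).fst'.fst'
  have hdims : CodeFP (pairE (glArgE p) (rowE p)) (pairE unE (pairE unE unE)) (fun q => q.1.1.2.1) := (fst _ _).fst'.snd'.fst'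
  have hrow : CodeFP (pairE (glArgE p) (rowE p)) strE (fun q => q.1.2) := (fst _ _).snd'
  have hr : CodeFP (pairE (glArgE p) (rowE p)) (rowE p) (fun q => q.2) := snd _ _
  have hblk : CodeFP (pairE (glArgE p) (rowE p)) strE (fun q => blockN p q.1.1.2.1.1 q.1.1.2.1.2.1 q.1.1.2.1.2.2 q.1.2 q.2) :=
    ((blockN_codeFP p).comp ((hdims.pair hrow).pair hr)).congr fun _ => rfl
  exact (zmodOfNat.comp (strVal.comp (hH'.comp (hV.pair hblk)))).congr fun q => by simp only [glOracleN]

/-- **`glValuesL` over the argument is a code** (`i` in the context). [folklore] -/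
theorem glValuesL_codeFP {H : List Bool → List Bool} (hH : H ∈ FP) :
    CodeFP (glCtxE p) (rowE p) (fun t => glValuesL t.1.1.2.1.2.1
      (glOracleN H t.1.1.1 t.1.1.2.1.1 t.1.1.2.1.2.1 t.1.1.2.1.2.2 t.1.2) t.1.1.2.2.2.2.1 t.1.1.2.2.2.2.2.1
      (repsListLN p t.1.1.2.2.1 t.1.1.2.2.2.1) t.2) := by
  let eι := pairE (glCtxE p) (rowE p)   -- context `⟨⟨Gr,row⟩,i⟩`, item `c`
  have hctx : CodeFP eι (glArgE p) (fun t => t.1.1) := (fst _ _).fst'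
  have hi : CodeFP eι natE (fun t => t.1.2) := (fst _ _).snd'
  have hc : CodeFP eι (rowE p) (fun t => t.2) := snd _ _
  have hkU : CodeFP eι unE (fun t => t.1.1.1.2.1.2.1) := hctx.fst'.snd'.fst'.snd'.fst'
  have hS : CodeFP eι (rawE (rowE p)) (fun t => t.1.1.1.2.2.2.2.1) := hctx.fst'.snd'.snd'.snd'.snd'.fst'
  have hσ : CodeFP eι (rowE p) (fun t => t.1.1.1.2.2.2.2.2.1) := hctx.fst'.snd'.snd'.snd'.snd'.snd'.fst'
  have hseed : CodeFP eι (rowE p) (fun t => seedCombL t.1.1.1.2.1.2.1 t.1.1.1.2.2.2.2.1 t.2) :=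
    ((seedCombL_codeFP p).comp (hkU.pair (hS.pair hc))).congr fun _ => rfl
  have hshift : CodeFP eι (rowE p) (fun t => shiftL t.1.1.1.2.1.2.1 (seedCombL t.1.1.1.2.1.2.1 t.1.1.1.2.2.2.2.1 t.2) t.1.2) :=
    ((shiftL_codeFP p).comp (hkU.pair (hseed.pair hi))).congr fun _ => rfl
  have hB : CodeFP eι (zmodE p) (fun t => glOracleN H t.1.1.1.1 t.1.1.1.2.1.1 t.1.1.1.2.1.2.1 t.1.1.1.2.1.2.2 t.1.1.2
      (shiftL t.1.1.1.2.1.2.1 (seedCombL t.1.1.1.2.1.2.1 t.1.1.1.2.2.2.2.1 t.2) t.1.2)) :=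
    ((glOracleN_codeFP p hH).comp (hctx.pair hshift)).congr fun _ => rfl
  have hgd : CodeFP eι (zmodE p) (fun t => guessDotL t.1.1.1.2.2.2.2.2.1 t.2) := ((guessDotL_codeFP p).comp (hσ.pair hc)).congr fun _ => rfl
  have hitem : CodeFP eι (zmodE p) (fun t => glOracleN H t.1.1.1.1 t.1.1.1.2.1.1 t.1.1.1.2.1.2.1 t.1.1.1.2.1.2.2 t.1.1.2
      (shiftL t.1.1.1.2.1.2.1 (seedCombL t.1.1.1.2.1.2.1 t.1.1.1.2.2.2.2.1 t.2) t.1.2) - guessDotL t.1.1.1.2.2.2.2.2.1 t.2) :=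
    (zmodSub.comp (hB.pair hgd)).congr fun _ => rfl
  have hreps : CodeFP (glCtxE p) (rawE (rowE p)) (fun t => repsListLN p t.1.1.2.2.1 t.1.1.2.2.2.1) :=
    ((repsListLN_codeFP p).comp ((fst _ _).fst'.snd'.snd'.fst'.pair (fst _ _).fst'.snd'.snd'.snd'.fst')).congr fun _ => rfl
  exact ((CodeFP.map hitem).comp ((CodeFP.id _).pair hreps)).congr fun t => by simp only [glValuesL, id]

/-- Counting a field element in a list of field elements. [folklore] -/
theorem zmodCount_codeFP : CodeFP (pairE (zmodE p) (rowE p)) natE (fun q => q.2.count q.1) := by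
  have hf := CodeFP.filter (σ := ZMod p) (eσ := zmodE p) (eα := zmodE p) (p := fun t => decide (t.2 = t.1))
    (((eq zmodE_injective).comp ((snd _ _).pair (fst _ _))).congr fun _ => rfl)
  exact ((natLength (zmodE p)).comp hf).congr fun q => by
    show (q.2.filter fun a => decide (a = q.1)).length = q.2.count q.1
    rw [List.count_eq_countP, List.countP_eq_length_filter]
    exact congrArg List.length (List.filter_congr fun x _ => Bool.eq_iff_iff.2 (by simp))

/-- **The cleared test is a code** (`(i, a)` in the context `⟨⟨⟨Gr, row⟩, i⟩, a⟩`). [folklore] -/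
theorem glTestL_codeFP {H : List Bool → List Bool} (hH : H ∈ FP) :
    CodeFP (pairE (glCtxE p) (zmodE p)) bitE (fun t => glTestL t.1.1.1.2.1.2.1
      (glOracleN H t.1.1.1.1 t.1.1.1.2.1.1 t.1.1.1.2.1.2.1 t.1.1.1.2.1.2.2 t.1.1.2) t.1.1.1.2.2.2.2.1 t.1.1.1.2.2.2.2.2.1
      (repsListLN p t.1.1.1.2.2.1 t.1.1.1.2.2.2.1) t.1.1.1.2.2.2.2.2.2.1 t.1.1.1.2.2.2.2.2.2.2 t.1.2 t.2) := by
  let eτ := pairE (glCtxE p) (zmodE p)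
  have hctx : CodeFP eτ (glCtxE p) (fun t => t.1) := fst _ _
  have ha : CodeFP eτ (zmodE p) (fun t => t.2) := snd _ _
  have hkU : CodeFP eτ unE (fun t => t.1.1.1.2.1.2.1) := hctx.fst'.fst'.snd'.fst'.snd'.fst'
  have hk : CodeFP eτ natE (fun t => t.1.1.1.2.1.2.1) := (natOfUn.comp hkU).congr fun _ => rfl
  have hθN : CodeFP eτ natE (fun t => t.1.1.1.2.2.2.2.2.2.1) := hctx.fst'.fst'.snd'.snd'.snd'.snd'.snd'.snd'.fst'
  have hθD : CodeFP eτ natE (fun t => t.1.1.1.2.2.2.2.2.2.2) := hctx.fst'.fst'.snd'.snd'.snd'.snd'.snd'.snd'.snd'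
  have hR : CodeFP eτ natE (fun t => (repsListLN p t.1.1.1.2.2.1 t.1.1.1.2.2.2.1).length) :=
    ((natLength (rowE p)).comp ((repsListLN_codeFP p).comp (hctx.fst'.fst'.snd'.snd'.fst'.pair hctx.fst'.fst'.snd'.snd'.snd'.fst'))).congr
      fun _ => rfl
  -- the two value lists: at the context's `i`, and at `k'` (no shift)
  have hLI := (glValuesL_codeFP p hH).comp hctx
  have hL0 := (glValuesL_codeFP p hH).comp (hctx.fst'.pair hk)
  refine (decideForallList (eα := eτ) (P := fun (w : ZMod p) (t : ((GlRecT p × List Bool) × ℕ) × ZMod p) =>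
      Nat.dist ((glValuesL t.1.1.1.2.1.2.1 (glOracleN H t.1.1.1.1 t.1.1.1.2.1.1 t.1.1.1.2.1.2.1 t.1.1.1.2.1.2.2 t.1.1.2)
        t.1.1.1.2.2.2.2.1 t.1.1.1.2.2.2.2.2.1 (repsListLN p t.1.1.1.2.2.1 t.1.1.1.2.2.2.1) t.1.2).count (t.2 + w))
        ((glValuesL t.1.1.1.2.1.2.1 (glOracleN H t.1.1.1.1 t.1.1.1.2.1.1 t.1.1.1.2.1.2.1 t.1.1.1.2.1.2.2 t.1.1.2)
        t.1.1.1.2.2.2.2.1 t.1.1.1.2.2.2.2.2.1 (repsListLN p t.1.1.1.2.2.1 t.1.1.1.2.2.2.1) t.1.1.1.2.1.2.1).count w) * t.1.1.1.2.2.2.2.2.2.2 ≤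
      2 * t.1.1.1.2.2.2.2.2.2.1 * (repsListLN p t.1.1.1.2.2.1 t.1.1.1.2.2.2.1).length)
    ((List.range p).map fun w : ℕ => (w : ZMod p)) fun w _ => ?_).congr fun t => by unfold glTestL; rw [decide_eq_decide]
  have hcI : CodeFP eτ natE (fun t => (glValuesL t.1.1.1.2.1.2.1 (glOracleN H t.1.1.1.1 t.1.1.1.2.1.1 t.1.1.1.2.1.2.1 t.1.1.1.2.1.2.2 t.1.1.2)
      t.1.1.1.2.2.2.2.1 t.1.1.1.2.2.2.2.2.1 (repsListLN p t.1.1.1.2.2.1 t.1.1.1.2.2.2.1) t.1.2).count (t.2 + w)) :=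
    ((zmodCount_codeFP p).comp (((zmodSub.comp (ha.pair (const _ (0 - w)))).congr fun _ => by ring).pair hLI)).congr
      fun _ => rfl
  have hc0 : CodeFP eτ natE (fun t => (glValuesL t.1.1.1.2.1.2.1 (glOracleN H t.1.1.1.1 t.1.1.1.2.1.1 t.1.1.1.2.1.2.1 t.1.1.1.2.1.2.2 t.1.1.2)
      t.1.1.1.2.2.2.2.1 t.1.1.1.2.2.2.2.2.1 (repsListLN p t.1.1.1.2.2.1 t.1.1.1.2.2.2.1) t.1.1.1.2.1.2.1).count w) :=
    ((zmodCount_codeFP p).comp ((const _ w).pair hL0)).congr fun _ => rfl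
  have hdist : CodeFP eτ natE (fun t =>
      Nat.dist ((glValuesL t.1.1.1.2.1.2.1 (glOracleN H t.1.1.1.1 t.1.1.1.2.1.1 t.1.1.1.2.1.2.1 t.1.1.1.2.1.2.2 t.1.1.2)
        t.1.1.1.2.2.2.2.1 t.1.1.1.2.2.2.2.2.1 (repsListLN p t.1.1.1.2.2.1 t.1.1.1.2.2.2.1) t.1.2).count (t.2 + w))
        ((glValuesL t.1.1.1.2.1.2.1 (glOracleN H t.1.1.1.1 t.1.1.1.2.1.1 t.1.1.1.2.1.2.1 t.1.1.1.2.1.2.2 t.1.1.2)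
        t.1.1.1.2.2.2.2.1 t.1.1.1.2.2.2.2.2.1 (repsListLN p t.1.1.1.2.2.1 t.1.1.1.2.2.2.1) t.1.1.1.2.1.2.1).count w)) :=
    (natAdd.comp ((natSub.comp (hcI.pair hc0)).pair (natSub.comp (hc0.pair hcI)))).congr fun _ => rfl
  exact (natLe.comp ((natMul.comp (hdist.pair hθD)).pair (natMul.comp ((natMul.comp ((const _ 2).pair hθN)).pair hR)))).congr
    fun _ => rfl

/-- **The recipe `candVecN` is a code** for `H ∈ FP`. [cite: AroraBarak2009, §1.3] -/
theorem candVec_codeFP {H : List Bool → List Bool} (hH : H ∈ FP) : CodeFP (glArgE p) strE (fun a => candVecN H a.1 a.2) := by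
  -- the candidate index at `i`: `findIdx` over `0, …, p - 1`
  let eτ := pairE (glCtxE p) natE   -- context `⟨⟨Gr,row⟩,i⟩`, item `a : ℕ`
  have htest : CodeFP eτ bitE (fun t => glTestL t.1.1.1.2.1.2.1
      (glOracleN H t.1.1.1.1 t.1.1.1.2.1.1 t.1.1.1.2.1.2.1 t.1.1.1.2.1.2.2 t.1.1.2) t.1.1.1.2.2.2.2.1 t.1.1.1.2.2.2.2.2.1
      (repsListLN p t.1.1.1.2.2.1 t.1.1.1.2.2.2.1) t.1.1.1.2.2.2.2.2.2.1 t.1.1.1.2.2.2.2.2.2.2 t.1.2 (t.2 : ZMod p)) :=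
    ((glTestL_codeFP p hH).comp ((fst _ _).pair (zmodOfNat.comp (snd _ _)))).congr fun _ => rfl
  have hfind := findIdxFP htest
  have hcand : CodeFP (glCtxE p) natE (fun t => glCandL t.1.1.2.1.2.1
      (glOracleN H t.1.1.1 t.1.1.2.1.1 t.1.1.2.1.2.1 t.1.1.2.1.2.2 t.1.2) t.1.1.2.2.2.2.1 t.1.1.2.2.2.2.2.1
      (repsListLN p t.1.1.2.2.1 t.1.1.2.2.2.1) t.1.1.2.2.2.2.2.2.1 t.1.1.2.2.2.2.2.2.2 t.2) :=
    (hfind.comp ((CodeFP.id _).pair (urange.comp (const _ p)))).congr fun t => by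
      simp only [glCandL, id]
  have hbit : CodeFP (glCtxE p) bitE (fun t => decide (glCandL t.1.1.2.1.2.1
      (glOracleN H t.1.1.1 t.1.1.2.1.1 t.1.1.2.1.2.1 t.1.1.2.1.2.2 t.1.2) t.1.1.2.2.2.2.1 t.1.1.2.2.2.2.2.1
      (repsListLN p t.1.1.2.2.1 t.1.1.2.2.2.1) t.1.1.2.2.2.2.2.2.1 t.1.1.2.2.2.2.2.2.2 t.2 = 1)) :=
    (natEq.comp (hcand.pair (const _ 1))).congr fun _ => rfl
  have hrange : CodeFP (glArgE p) (rawE natE) (fun a => List.range a.1.2.1.2.1) := urange.comp (fst _ _).snd'.fst'.snd'.fst'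
  have hmap := (CodeFP.map hbit).comp ((CodeFP.id _).pair hrange)
  exact (bitsToStr.comp hmap).congr fun a => rfl

end Codes

/-! ### The string function -/

/-- **The GL stage as a string function** for the predictor string function `H` (the code of
`candVec_codeFP` when `H ∈ FP`, the empty function otherwise). [cite: CarmosinoImpagliazzoKabanetsKolokolova2016, Thm. 4.2 / §5 (step 4)] -/
noncomputable def candVecPFn (p : ℕ) [Fact p.Prime] (H : List Bool → List Bool) : List Bool → List Bool := by
  classical
  exact if h : H ∈ FP then Classical.choose (candVec_codeFP p h) else fun _ => []

/-- `candVecPFn H ∈ FP` for `H ∈ FP`. [cite: AroraBarak2009, §1.3] -/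
theorem candVecPFn_mem_FP {H : List Bool → List Bool} (hH : H ∈ FP) : candVecPFn p H ∈ FP := by
  unfold candVecPFn
  rw [dif_pos hH]
  exact (Classical.choose_spec (candVec_codeFP p hH)).1

/-- **Value of `candVecPFn`**: the recipe. [folklore] -/
theorem candVecPFn_apply {H : List Bool → List Bool} (hH : H ∈ FP) (Gr : GlRecT p) (row : List Bool) :
    candVecPFn p H (glArgE p (Gr, row)) = candVecN H Gr row := by
  unfold candVecPFn
  rw [dif_pos hH]
  exact (Classical.choose_spec (candVec_codeFP p hH)).2 (Gr, row)

/-- **The GL stage computes `glStageP`** on the genuine record, for every row of strings: the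
hypothesis `hG` of `decodeFn_apply`. [cite: CarmosinoImpagliazzoKabanetsKolokolova2016, Thm. 4.2 / Claim 4.4 / Thm. 4.7] -/
theorem candVecPFn_apply_genuine (hβ : p ≤ 2 ^ β) {H : List Bool → List Bool} (hH : H ∈ FP) (P : List Bool)
    (h₁ : (Fin (T * 2 * (k * n + k * β)) → Bool) → Bool)
    (hHP : ∀ x : Fin (T * 2 * (k * n + k * β)) → Bool, H (boolPair P (List.ofFn x)) = [h₁ x])
    (f : (Fin n → Bool) → Bool) (c : VNCoins (SBlk n k p β) T p) (s : Fin kk → FVec p k) (σ : Fin kk → ZMod p)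
    {θN θD : ℕ} (hθD : 0 < θD) (v : Fin k → (Fin (n + β) → Bool)) :
    candVecPFn p H (boolPair (glRecE p (glRecOf (vnRecOf P (dpGLP (fJ (p := p) (β := β) f)) c) n k β kk s σ θN θD)) (tupleBits v)) =
      List.ofFn (glStageP (vnStageP f h₁ c) ((θN : ℝ) / θD) (s, σ) fun i => decodeRow (jB_pos hβ) (v i)) := by
  rw [show boolPair (glRecE p (glRecOf (vnRecOf P (dpGLP (fJ (p := p) (β := β) f)) c) n k β kk s σ θN θD)) (tupleBits v) =
    glArgE p (glRecOf (vnRecOf P (dpGLP (fJ (p := p) (β := β) f)) c) n k β kk s σ θN θD, tupleBits v) from rfl,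
    candVecPFn_apply hH, candVecN_eq hβ H P h₁ hHP f c s σ hθD v]

end Literature.Computability.Learning
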